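import Summits.RiemannHypothesis.RiemannHypothesis.Theorems.WeilWindowFlowGronwallLeakageStrictAnti
import Summits.RiemannHypothesis.RiemannHypothesis.Theorems.WeilWindowFlowGronwallLeakageMaximalFlow
import HarnessLib

/-!
# Strict antitonicity of the window bottom — consequences for the Grönwall flow
(crux stmt-RiemannHypothesis-1037 `GronwallLeakage`, route WeilWindowFlow; line `Sketch`, lead c6)

With `weilGroundEnergy_strictAntiOn` (ε strictly decreasing on `(0, ∞)`, `…StrictAnti.lean`) and the
maximal-flow package (`…MaximalFlow.lean`):

* `leakage_law_of_weilPositivityOn` — below any certified rung `WeilPositivityOn A` the crux's law holds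
  with the canonical rate on every `[b, a] ⊂ (0, A)` (strict positivity there + `leakage_identity_of_pos`);
  so each proved rung (`PrimeTwoWindow`; item 0100's `(log 3)/2` once certified) extends the unconditional
  initial segment of `X`;
* `exists_conjugatePoint_sharp_of_not_riemannHypothesis` — under `¬RH` the first conjugate point
  `a⋆ > (log 2)/2` is the LAST positive window: `ε > 0` on `(0, a⋆)`, `ε a⋆ = 0`, `ε < 0` on `(a⋆, ∞)`;
* `setOf_weilPositivityOn_eq_Ioc_of_not_riemannHypothesis` — `{a > 0 | WeilPositivityOn a} = (0, a⋆]`;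
* `gronwallLeakage_iff_forall_exists_rung` — `X ⟺` certified rungs are cofinal in `(0, ∞)`.

Axioms ⊆ {propext, Classical.choice, Quot.sound}.
-/

-- `Summit.RiemannHypothesis.RiemannHypothesis.…` repeats a namespace component by design (D-0017 layout).
set_option linter.dupNamespace false

noncomputable section

open MeasureTheory Set Filter

namespace Summit.RiemannHypothesis.RiemannHypothesis.Theorems.WeilWindowFlowGronwallLeakage

open Literature.NumberTheory.LFunctions
open Summit.RiemannHypothesis.RiemannHypothesis.Theses.WeilWindowFlow
open Summit.RiemannHypothesis.Cruxes.GronwallLeakage.Negative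

/-- **A certified rung gives the crux's leakage law strictly below it** (canonical rate): if
`WeilPositivityOn A` then for all `0 < b ≤ a < A` the rate `C₀ = -(log ∘ ε)'` is integrable on
`[b, a]` and `ε b · exp (-∫_b^a C₀) ≤ ε a`. So every proved rung (e.g. `PrimeTwoWindow`, or item 0100's
`WeilPositivityOn ((log 3)/2)` once certified) extends the unconditional initial segment of `X`.
[folklore] -/
theorem leakage_law_of_weilPositivityOn {A : ℝ} (hA : WeilPositivityOn A) :
    ∀ b a : ℝ, 0 < b → b ≤ a → a < A →
      IntervalIntegrable (fun x ↦ -deriv (fun y ↦ Real.log (weilGroundEnergy y)) x) volume b a ∧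
      weilGroundEnergy b *
          Real.exp (-(∫ x in b..a, -deriv (fun y ↦ Real.log (weilGroundEnergy y)) x)) ≤
        weilGroundEnergy a := by
  intro b a hb hba haA
  obtain ⟨hint, heq⟩ := leakage_identity_of_pos hb hba
    (weilGroundEnergy_pos_of_weilPositivityOn_of_lt hA (hb.trans_le hba) haA)
  exact ⟨hint, heq.le⟩


/-- **`¬RH`, located and sharpened.** If RH fails, the first conjugate point `a⋆ > (log 2)/2` of the
flow is the LAST window with Weil positivity: `ε > 0` on `(0, a⋆)`, `ε a⋆ = 0`, and `ε < 0` on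
`(a⋆, ∞)`. [folklore] -/
theorem exists_conjugatePoint_sharp_of_not_riemannHypothesis (hRH : ¬ _root_.RiemannHypothesis) :
    ∃ aStar : ℝ, Real.log 2 / 2 < aStar ∧ weilGroundEnergy aStar = 0 ∧
      (∀ a : ℝ, 0 < a → a < aStar → 0 < weilGroundEnergy a) ∧
      (∀ a : ℝ, aStar < a → weilGroundEnergy a < 0) := by
  obtain ⟨aStar, hgt, hzero, hbefore, -⟩ := exists_conjugatePoint_of_not_riemannHypothesis hRH
  have hlog : 0 < Real.log 2 / 2 := by
    have := Real.log_pos one_lt_two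
    positivity
  exact ⟨aStar, hgt, hzero, hbefore, fun a ha ↦
    weilGroundEnergy_neg_of_eq_zero_of_lt (hlog.trans hgt) hzero ha⟩


/-- **Under `¬RH` the positive windows form exactly an interval `(0, a⋆]`**, `a⋆ > (log 2)/2` the
conjugate point: `{a | 0 < a ∧ WeilPositivityOn a} = Ioc 0 a⋆`. [folklore] -/
theorem setOf_weilPositivityOn_eq_Ioc_of_not_riemannHypothesis (hRH : ¬ _root_.RiemannHypothesis) :
    ∃ aStar : ℝ, Real.log 2 / 2 < aStar ∧
      {a : ℝ | 0 < a ∧ WeilPositivityOn a} = Ioc 0 aStar := by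
  obtain ⟨aStar, hgt, hzero, hbefore, hafter⟩ :=
    exists_conjugatePoint_sharp_of_not_riemannHypothesis hRH
  have hlog : 0 < Real.log 2 / 2 := by
    have := Real.log_pos one_lt_two
    positivity
  have haStar : 0 < aStar := hlog.trans hgt
  refine ⟨aStar, hgt, Set.ext fun a ↦ ⟨?_, ?_⟩⟩
  · rintro ⟨ha, hpos⟩
    refine ⟨ha, le_of_not_gt fun hlt ↦ ?_⟩
    exact (hafter a hlt).not_ge ((weilGroundEnergy_nonneg_iff_holds ha).2 hpos)
  · rintro ⟨ha, hle⟩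
    refine ⟨ha, (weilGroundEnergy_nonneg_iff_holds ha).1 ?_⟩
    rcases hle.lt_or_eq with hlt | heq
    · exact (hbefore a ha hlt).le
    · rw [heq, hzero]


/-- **`X` on the sharp unconditional range, restated with strictness**: `GronwallLeakage` holds iff
the bottom never vanishes, iff it is positive at every window, iff Weil positivity holds on every window;
and WHEREVER a single rung `WeilPositivityOn A` is certified, the whole initial segment `(0, A)` carries
strict positivity and the leakage law (`leakage_law_of_weilPositivityOn`). In particular the crux is
equivalent to: for every `A > 0` there is a certified rung at or above `A`. [folklore] -/
theorem gronwallLeakage_iff_forall_exists_rung :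
    GronwallLeakage ↔ ∀ A : ℝ, 0 < A → ∃ A' : ℝ, A ≤ A' ∧ WeilPositivityOn A' := by
  constructor
  · intro hX A hA
    exact ⟨A, le_rfl, (weilGroundEnergy_nonneg_iff_holds hA).1
      (weilGroundEnergy_pos_of_gronwallLeakage hX hA).le⟩
  · intro h
    refine gronwallLeakage_iff_forall_nonneg.2 fun a ha ↦ ?_
    obtain ⟨A', hle, hpos⟩ := h a ha
    rcases hle.lt_or_eq with hlt | heq
    · exact (weilGroundEnergy_pos_of_weilPositivityOn_of_lt hpos ha hlt).le
    · exact (weilGroundEnergy_nonneg_iff_holds ha).2 (heq ▸ hpos)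


end Summit.RiemannHypothesis.RiemannHypothesis.Theorems.WeilWindowFlowGronwallLeakage

end
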